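import Literature.AlgebraicGeometry.Limits.LocalizationTwoOpensDescent
import Literature.RingTheory.Localization.FinitePresentationDescent
import HarnessLib

/-!
# Limits of schemes: schemes of finite presentation over `Spec A_S` descend to `Spec A` (Stacks 01ZM)

Topic: `Literature/AlgebraicGeometry/Limits`; conclusion of the series on the localization diagram
`Spec A_S = lim_s Spec A[1/s]` (`Limits/LocalizationDiagram`, …, `Limits/LocalizationTwoOpensDescent`).
Main result (`LocApprox.exists_iso_pullback`): let `B` be a localization of the commutative ring
`A` and `X → Spec B` a quasi-compact, quasi-separated morphism locally of finite presentation.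
Then **`X ≅ P ×_A Spec B` over `Spec B` for an `A`-scheme `P → Spec A` which is quasi-compact,
quasi-separated and locally of finite presentation.** This is EGA IV₃ Thm. 8.8.2 (ii) / The
Stacks project, Tag 01ZM (schemes of finite presentation over a limit `lim Sᵢ` of schemes with
affine transition maps come from a finite stage; Görtz–Wedhorn I, Thm. 10.66) for the cofiltered
system of basic open neighbourhoods `Spec A[1/s]`, `s ∈ S`, in the stage-free form special to
localizations (a scheme over some `Spec A[1/s]` is a scheme over `Spec A` with the same base
change to `Spec B`). With `S = A ∖ 𝔭`: a scheme of finite presentation over the local ring `A_𝔭`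
extends to a scheme of finite presentation over `A` (and then, by `Limits/LocalizationSmoothSpread`
and `Limits/LocalizationSeparatedSpread`, smoothness and separatedness over `A_𝔭` spread to a
neighbourhood `D(s)` of `𝔭`); consumer: the one-bad-prime gluing of Néron models
(`Literature.NumberTheory.EllipticCurves.NeronModelOnePrime`).

## Proof

Induction on a finite affine open cover of `X` (`exists_iso_pullback_sSup`): an affine open
`U = Spec C` descends because the finitely presented `B`-algebra `C` is `B ⊗[A] C₀` for a finitely
presented `A`-algebra `C₀` (`Literature.RingTheory.Localization.exists_finitePresentation_tensorProduct_algEquiv`,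
clearing denominators; `exists_iso_pullback_of_isAffineOpen`), and the union of two descended
quasi-compact opens descends by `exists_iso_pullback_of_two_charts`
(`Limits/LocalizationTwoOpensDescent`: descend the quasi-compact overlap to a stage, spread out the
identification of the two descended overlaps compatibly, glue by a pushout along open
immersions, and compare), the intersection being quasi-compact because `X` is quasi-separated
(`exists_iso_pullback_sup`).

## References

* A. Grothendieck, EGA IV₃, Thm. 8.8.2 (ii) (Publ. Math. IHÉS 28, 1966). [EGAIV3]
* The Stacks project, Tag 01ZM. [StacksProject]
* U. Görtz, T. Wedhorn, *Algebraic Geometry I: Schemes*, 2nd ed. (2020), Thm. 10.66, p. 330.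
  [GortzWedhorn2020]
-/

noncomputable section

universe u

open CategoryTheory CategoryTheory.Limits AlgebraicGeometry TopologicalSpace MonoidalCategory
  CartesianMonoidalCategory TensorProduct
open Opposite

namespace Literature.AlgebraicGeometry.Limits

namespace LocApprox

open Literature.AlgebraicGeometry.Motives (SchemeOver specOver)

set_option backward.isDefEq.respectTransparency false

variable {A : Type u} [CommRing A] (S : Submonoid A) (B : Type u) [CommRing B] [Algebra A B]

/-! ## The affine case -/

section Affine

/-- **Affine case of Stacks 01ZM for a localization:** `Spec C`, `C` a finitely presented
`B`-algebra (`B = A_S`), is the base change of `Spec C₀` for a finitely presented `A`-algebra `C₀`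
(`exists_finitePresentation_tensorProduct_algEquiv`: `C ≅ B ⊗[A] C₀`; Mathlib `pullbackSpecIso`).
[cite: StacksProject, Tag 01ZM (affine case)] -/
theorem exists_iso_pullback_specOver [IsLocalization S B] (C : Type u) [CommRing C] [Algebra B C]
    [Algebra A C] [IsScalarTower A B C] [Algebra.FinitePresentation B C] :
    ∃ (P : SchemeOver A), QuasiCompact P.hom ∧ QuasiSeparated P.hom ∧
      LocallyOfFinitePresentation P.hom ∧
        Nonempty ((Over.pullback (specOver A B).hom).obj P ≅ specOver B C) := by
  obtain ⟨C₀, _, _, hfp, ⟨ε⟩⟩ :=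
    Literature.RingTheory.Localization.exists_finitePresentation_tensorProduct_algEquiv B C S
  have hlfp : LocallyOfFinitePresentation (specOver A C₀).hom :=
    (HasRingHomProperty.Spec_iff (P := @LocallyOfFinitePresentation)).mpr
      (RingHom.finitePresentation_algebraMap.mpr hfp)
  refine ⟨specOver A C₀,
    inferInstanceAs (QuasiCompact (Spec.map (CommRingCat.ofHom (algebraMap A C₀)))),
    inferInstanceAs (QuasiSeparated (Spec.map (CommRingCat.ofHom (algebraMap A C₀)))), hlfp, ⟨?_⟩⟩
  -- the ring isomorphism `C₀ ⊗[A] B ≅ C` and its compatibility with `B`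
  let r : C₀ ⊗[A] B ≃+* C := (Algebra.TensorProduct.comm A C₀ B).toRingEquiv.trans ε.toRingEquiv
  have hr : ∀ b : B, r ((Algebra.TensorProduct.includeRight (R := A) (A := C₀)) b) = algebraMap B C b := by
    intro b
    change ε (Algebra.TensorProduct.comm A C₀ B ((1 : C₀) ⊗ₜ[A] b)) = algebraMap B C b
    rw [Algebra.TensorProduct.comm_tmul]
    have h := ε.commutes b
    rwa [Algebra.TensorProduct.algebraMap_apply, Algebra.algebraMap_self, RingHom.id_apply] at h
  have hcomp : CommRingCat.ofHom (algebraMap B C) ≫ CommRingCat.ofHom r.symm.toRingHom =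
      CommRingCat.ofHom (Algebra.TensorProduct.includeRight (R := A) (A := C₀) (B := B)).toRingHom := by
    ext b
    change r.symm (algebraMap B C b) = Algebra.TensorProduct.includeRight b
    rw [← hr, RingEquiv.symm_apply_apply]
  let e₂ : Spec (CommRingCat.of (C₀ ⊗[A] B)) ≅ Spec (CommRingCat.of C) :=
    (Scheme.Spec.mapIso r.toCommRingCatIso.op).symm
  have he₂ : e₂.hom = Spec.map (CommRingCat.ofHom r.symm.toRingHom) := rfl
  refine Over.isoMk (pullbackSpecIso A C₀ B ≪≫ e₂) ?_
  change (pullbackSpecIso A C₀ B ≪≫ e₂).hom ≫ Spec.map (CommRingCat.ofHom (algebraMap B C)) =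
    pullback.snd _ _
  rw [Iso.trans_hom, Category.assoc, he₂, ← Spec.map_comp, hcomp, ← pullbackSpecIso_hom_snd]
  rfl

/-- **An affine open subscheme of a `B`-scheme locally of finite presentation descends to `A`**
(`B = A_S`): it is `Spec` of a finitely presented `B`-algebra. [cite: StacksProject, Tag 01ZM] -/
theorem exists_iso_pullback_of_isAffineOpen [IsLocalization S B] (X : SchemeOver B)
    [LocallyOfFinitePresentation X.hom] (U : X.left.Opens) (hU : IsAffineOpen U) :
    ∃ (P : SchemeOver A), QuasiCompact P.hom ∧ QuasiSeparated P.hom ∧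
      LocallyOfFinitePresentation P.hom ∧
        Nonempty ((Over.pullback (specOver A B).hom).obj P ≅ Over.mk (U.ι ≫ X.hom)) := by
  let φ : CommRingCat.of B ⟶ Γ(X.left, U) := Spec.preimage (hU.isoSpec.inv ≫ U.ι ≫ X.hom)
  have hφ : Spec.map φ = hU.isoSpec.inv ≫ U.ι ≫ X.hom := Spec.map_preimage _
  letI : Algebra B Γ(X.left, U) := φ.hom.toAlgebra
  letI : Algebra A Γ(X.left, U) := (φ.hom.comp (algebraMap A B)).toAlgebra
  haveI : IsScalarTower A B Γ(X.left, U) := IsScalarTower.of_algebraMap_eq fun _ => rfl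
  haveI : Algebra.FinitePresentation B Γ(X.left, U) := by
    have h : LocallyOfFinitePresentation (Spec.map φ) := by rw [hφ]; infer_instance
    exact (HasRingHomProperty.Spec_iff (P := @LocallyOfFinitePresentation)).mp h
  obtain ⟨P, h₁, h₂, h₃, ⟨e⟩⟩ := exists_iso_pullback_specOver S B Γ(X.left, U)
  refine ⟨P, h₁, h₂, h₃, ⟨e ≪≫ Over.isoMk hU.isoSpec.symm ?_⟩⟩
  change hU.isoSpec.inv ≫ U.ι ≫ X.hom = Spec.map (CommRingCat.ofHom φ.hom)
  rw [CommRingCat.ofHom_hom, hφ]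

end Affine

/-! ## The union of two descended opens -/

section Union

variable {B}

/-- The range of the inclusion `U → V` of open subschemes (`U ≤ V`) is the preimage of `U`.
[folklore] -/
theorem range_homOfLE {Y : Scheme.{u}} {U V : Y.Opens} (h : U ≤ V) :
    Set.range (Y.homOfLE h) = V.ι ⁻¹' (U : Set Y) := by
  have hc : Set.range (Y.homOfLE h ≫ V.ι) = (U : Set Y) := by
    rw [Scheme.homOfLE_ι, Scheme.Opens.range_ι]
  rw [← hc, Scheme.Hom.comp_base, TopCat.coe_comp, Set.range_comp,
    Set.preimage_image_eq _ V.ι.isOpenEmbedding.injective]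

/-- An open subscheme which is a base change of a quasi-compact `A`-scheme is quasi-compact.
[folklore] -/
theorem isCompact_of_iso_pullback {X : SchemeOver B} (U : X.left.Opens) (P : SchemeOver A)
    [QuasiCompact P.hom] (e : (Over.pullback (specOver A B).hom).obj P ≅ Over.mk (U.ι ≫ X.hom)) :
    IsCompact (U : Set X.left) := by
  haveI : CompactSpace (specOver A B).left := inferInstanceAs (CompactSpace (Spec (CommRingCat.of B)))
  haveI : CompactSpace ((Over.pullback (specOver A B).hom).obj P).left :=
    SubalgApprox.compactSpace_tensorObj_left P (T := specOver A B)
  have hc : CompactSpace (U : Scheme.{u}) := (e.hom.left.homeomorph).compactSpace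
  exact isCompact_iff_compactSpace.mpr hc

/-- **The union of two descended open subschemes of a quasi-separated `B`-scheme descends.**
[cite: StacksProject, Tag 01ZM] -/
theorem exists_iso_pullback_sup [IsLocalization S B] (X : SchemeOver B) [QuasiSeparatedSpace X.left]
    (U V : X.left.Opens)
    (hU : ∃ (P : SchemeOver A), QuasiCompact P.hom ∧ QuasiSeparated P.hom ∧
      LocallyOfFinitePresentation P.hom ∧
        Nonempty ((Over.pullback (specOver A B).hom).obj P ≅ Over.mk (U.ι ≫ X.hom)))
    (hV : ∃ (P : SchemeOver A), QuasiCompact P.hom ∧ QuasiSeparated P.hom ∧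
      LocallyOfFinitePresentation P.hom ∧
        Nonempty ((Over.pullback (specOver A B).hom).obj P ≅ Over.mk (V.ι ≫ X.hom))) :
    ∃ (P : SchemeOver A), QuasiCompact P.hom ∧ QuasiSeparated P.hom ∧
      LocallyOfFinitePresentation P.hom ∧
        Nonempty ((Over.pullback (specOver A B).hom).obj P ≅ Over.mk ((U ⊔ V).ι ≫ X.hom)) := by
  obtain ⟨P₁, _, _, _, ⟨e₁⟩⟩ := hU
  obtain ⟨P₂, _, _, _, ⟨e₂⟩⟩ := hV
  have hUc : IsCompact (U : Set X.left) := isCompact_of_iso_pullback U P₁ e₁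
  have hVc : IsCompact (V : Set X.left) := isCompact_of_iso_pullback V P₂ e₂
  -- the two charts of `U ⊔ V`
  let Y : SchemeOver B := Over.mk ((U ⊔ V).ι ≫ X.hom)
  let j₁ : Over.mk (U.ι ≫ X.hom) ⟶ Y := Over.homMk (X.left.homOfLE (le_sup_left : U ≤ U ⊔ V))
    (by change X.left.homOfLE _ ≫ (U ⊔ V).ι ≫ X.hom = U.ι ≫ X.hom
        rw [← Category.assoc, Scheme.homOfLE_ι])
  let j₂ : Over.mk (V.ι ≫ X.hom) ⟶ Y := Over.homMk (X.left.homOfLE (le_sup_right : V ≤ U ⊔ V))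
    (by change X.left.homOfLE _ ≫ (U ⊔ V).ι ≫ X.hom = V.ι ≫ X.hom
        rw [← Category.assoc, Scheme.homOfLE_ι])
  let u₁ : (Over.pullback (specOver A B).hom).obj P₁ ⟶ Y := e₁.hom ≫ j₁
  let u₂ : (Over.pullback (specOver A B).hom).obj P₂ ⟶ Y := e₂.hom ≫ j₂
  haveI : IsOpenImmersion u₁.left := by
    change IsOpenImmersion (e₁.hom.left ≫ X.left.homOfLE le_sup_left); infer_instance
  haveI : IsOpenImmersion u₂.left := by
    change IsOpenImmersion (e₂.hom.left ≫ X.left.homOfLE le_sup_right); infer_instance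
  have hr₁ : Set.range u₁.left = (U ⊔ V).ι ⁻¹' (U : Set X.left) :=
    (range_iso_hom_left_comp e₁ (X.left.homOfLE le_sup_left)).trans (range_homOfLE le_sup_left)
  have hr₂ : Set.range u₂.left = (U ⊔ V).ι ⁻¹' (V : Set X.left) :=
    (range_iso_hom_left_comp e₂ (X.left.homOfLE le_sup_right)).trans (range_homOfLE le_sup_right)
  have hcov : Set.range u₁.left ∪ Set.range u₂.left = Set.univ := by
    rw [hr₁, hr₂, ← Set.preimage_union]
    exact Set.eq_univ_of_forall fun w => w.2
  have hqc : IsCompact (Set.range u₁.left ∩ Set.range u₂.left) := by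
    rw [hr₁, hr₂, ← Set.preimage_inter]
    refine ((U ⊔ V).ι.isOpenEmbedding.isInducing.isCompact_preimage_iff ?_).mpr
      (QuasiSeparatedSpace.inter_isCompact _ _ U.2 hUc V.2 hVc)
    rw [Scheme.Opens.range_ι]
    exact Set.inter_subset_left.trans (le_sup_left : U ≤ U ⊔ V)
  exact exists_iso_pullback_of_two_charts S B Y P₁ P₂ u₁ u₂ hcov hqc

end Union

/-! ## Finite affine covers, and the theorem -/

section Main

variable {B}

/-- The union of finitely many affine open subschemes of a quasi-separated `B`-scheme locally of
finite presentation descends to `A` (induction on the number of affine opens, from the affine case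
and the union of two). [cite: StacksProject, Tag 01ZM] -/
theorem exists_iso_pullback_sSup [IsLocalization S B] (X : SchemeOver B) [QuasiSeparatedSpace X.left]
    [LocallyOfFinitePresentation X.hom] (Us : Set X.left.Opens) (hfin : Us.Finite)
    (hUs : Us ⊆ X.left.affineOpens) :
    ∃ (P : SchemeOver A), QuasiCompact P.hom ∧ QuasiSeparated P.hom ∧
      LocallyOfFinitePresentation P.hom ∧
        Nonempty ((Over.pullback (specOver A B).hom).obj P ≅ Over.mk ((sSup Us).ι ≫ X.hom)) := by
  induction Us, hfin using Set.Finite.induction_on with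
  | empty =>
    rw [sSup_empty]
    exact exists_iso_pullback_of_isAffineOpen S B X ⊥ (isAffineOpen_bot X.left)
  | @insert U Us _ _ ih =>
    rw [sSup_insert]
    exact exists_iso_pullback_sup S X U (sSup Us)
      (exists_iso_pullback_of_isAffineOpen S B X U (hUs (Set.mem_insert _ _)))
      (ih (fun V hV => hUs (Set.mem_insert_of_mem _ hV)))

/-- **Schemes of finite presentation over a localization descend to the base ring** (EGA IV₃
Thm. 8.8.2 (ii); The Stacks project, Tag 01ZM; Görtz–Wedhorn I, Thm. 10.66 — for the limit
`Spec A_S = lim_{s ∈ S} Spec A[1/s]`). Let `B` be a localization of `A` at `S` and `X → Spec B`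
quasi-compact, quasi-separated and locally of finite presentation. Then there is an `A`-scheme
`P → Spec A`, quasi-compact, quasi-separated and locally of finite presentation, with
`P ×_A Spec B ≅ X` over `Spec B`. (A scheme of finite presentation over a finite stage
`Spec A[1/s]` is in particular such a `P`, the base change to `Spec B` being insensitive to the
intermediate open stage; conversely `P ×_A Spec A[1/s]` recovers a model over a stage.)
[cite: StacksProject, Tag 01ZM] [cite: EGAIV3, Thm. 8.8.2 (ii)]
[cite: GortzWedhorn2020, Thm. 10.66, p. 330] -/
theorem exists_iso_pullback [IsLocalization S B] (X : SchemeOver B) [QuasiCompact X.hom]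
    [QuasiSeparated X.hom] [LocallyOfFinitePresentation X.hom] :
    ∃ (P : SchemeOver A), QuasiCompact P.hom ∧ QuasiSeparated P.hom ∧
      LocallyOfFinitePresentation P.hom ∧
        Nonempty ((Over.pullback (specOver A B).hom).obj P ≅ X) := by
  haveI : CompactSpace X.left := QuasiCompact.compactSpace_of_compactSpace X.hom
  haveI : QuasiSeparatedSpace X.left := quasiSeparatedSpace_of_quasiSeparated X.hom
  obtain ⟨Us, hUs, hfin, htop⟩ := X.left.isBasis_affineOpens.exists_finite_of_isCompact
    (U := (⊤ : X.left.Opens)) (by simpa using isCompact_univ)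
  obtain ⟨P, h₁, h₂, h₃, ⟨e⟩⟩ := exists_iso_pullback_sSup S X Us hfin hUs
  refine ⟨P, h₁, h₂, h₃, ⟨e ≪≫ ?_⟩⟩
  rw [← htop]
  exact Over.isoMk X.left.topIso (by rw [Scheme.topIso_hom]; rfl)

end Main

end LocApprox

end Literature.AlgebraicGeometry.Limits

end
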